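import Mathlib
import Literature.MathematicalPhysics.MHD.GradShafranov
import HarnessLib

/-!
# Flux-surface functionals along a POLAR RAY parametrisation: the arc-length / gradient cancellation
# `|γ′(θ)| / |∇ψ(γ(θ))| = ρ(θ)/|∂ψ/∂ρ|` and Freidberg's safety factor (6.35) as a plain `θ`-integral

Venture LADDER-GRIDFUSION, `Summits/Ventures/FusionMHD/Models/` (namespace `Summit.Ventures.FusionMHD.Models.PolarRay`; a MODEL-SIDE
tool file: elementary calculus, [folklore], about the flux-surface functionals AS PRINTED in [cite: Freidberg2014, §6.3.5 eq. (6.35)] (`q = (F/2π)∮ dl/(R²B_p)`,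
tree decl `GradShafranov.safetyFactorE` with EUCLIDEAN arc length `GradShafranov.speed`; not a Literature file because the identities are ours, not a printed theorem).

WHY (LADDER-GRIDFUSION, rung F2 item R2 «q on a surface ψ = c» of `pub/gridfusion/models/F2-SCOPING.md` §6(d): «level set of an
enclosed C² function — standard interval-Newton in 1-D per ray, but nobody has built it here»).  When a flux surface `{ψ = c}` is
star-shaped about a point `(R_c, Z_c)` it is the polar-ray loop `γ(θ) = (R_c + ρ(θ) cos θ, Z_c + ρ(θ) sin θ)` for the ray radius
`ρ(θ) > 0` solving `ψ(γ(θ)) = c`.  Differentiating the level condition gives `ρ′·D_r + ρ·D_t = 0` with the RADIAL and TANGENTIAL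
derivatives `D_r = ψ_R cos θ + ψ_Z sin θ`, `D_t = −ψ_R sin θ + ψ_Z cos θ`; since `|∇ψ|² = D_r² + D_t²` and `|γ′|² = ρ′² + ρ²`,
**`|γ′(θ)|·|D_r(θ)| = ρ(θ)·|∇ψ(γ(θ))|`** — the tangential derivative and `ρ′` CANCEL.  Consequently every functional
`∮ g dl/|∇ψ|` over the surface equals `∫₀^{2π} g(γ(θ))·ρ(θ)/|D_r(θ)| dθ`, in particular
**`q(c) = (F/2π) ∫₀^{2π} ρ(θ) / (R(θ)·|D_r(θ)|) dθ`** (`B_p = |∇ψ|/R`): NO tube around the level set, NO `ρ′`, NO arc length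
— a certificate needs, per `θ`-panel, only an enclosure of the ray root `ρ(θ)` (sign change of `ψ − c` between two radii plus
`D_r > 0` on the box: §3) and an interval evaluation of `ρ/(R·D_r)`.

CONTENTS: §1 the polar-ray loop and its derivative; §2 the pointwise cancellation under a Fréchet-differentiability hypothesis on
`ψ` at the point (the partials `GradShafranov.dR/dZ` then agree with the Fréchet derivative) and the rewrite of the `(6.35)`
integrand; the `θ`-integral form of `safetyFactorE` on `[0, 2π]`; §3 the ray-root bracketing lemma (strictly increasing ray
profile + sign change ⇒ unique root in the bracket).  MODELLED: nothing — pure calculus about the printed definitions; whether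
a given equilibrium's surfaces are star-shaped about the axis is an instance fact to be certified per surface.
Written by gridfusion-model-7 (g2), 2026-08-27.
-/

noncomputable section

open Real Set MeasureTheory intervalIntegral
open Literature.MathematicalPhysics.MHD.GradShafranov

namespace Summit.Ventures.FusionMHD.Models

namespace PolarRay

/-! ## §1 The polar-ray loop about `(R_c, Z_c)` with ray radius `ρ(θ)` -/

/-- The polar-ray loop `γ(θ) = (R_c + ρ(θ) cos θ, Z_c + ρ(θ) sin θ)`. [folklore] -/
def loop (Rc Zc : ℝ) (ρ : ℝ → ℝ) (θ : ℝ) : ℝ × ℝ := (Rc + ρ θ * cos θ, Zc + ρ θ * sin θ)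

/-- The point of the ray from `(R_c, Z_c)` in direction `θ` at radius `s`. [folklore] -/
def rayPoint (Rc Zc θ s : ℝ) : ℝ × ℝ := (Rc + s * cos θ, Zc + s * sin θ)

/-- `γ(θ)` is the ray point at radius `ρ(θ)`. [folklore] -/
theorem loop_eq_rayPoint (Rc Zc : ℝ) (ρ : ℝ → ℝ) (θ : ℝ) : loop Rc Zc ρ θ = rayPoint Rc Zc θ (ρ θ) := rfl

/-- RADIAL derivative `D_r = ψ_R cos θ + ψ_Z sin θ` of a function with partials `(ψ_R, ψ_Z)`. [folklore] -/
def radialDeriv (ψR ψZ θ : ℝ) : ℝ := ψR * cos θ + ψZ * sin θ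

/-- TANGENTIAL derivative `D_t = −ψ_R sin θ + ψ_Z cos θ`. [folklore] -/
def tangentialDeriv (ψR ψZ θ : ℝ) : ℝ := -ψR * sin θ + ψZ * cos θ

/-- `|∇ψ|² = D_r² + D_t²` (rotation of the orthonormal frame). [folklore] -/
theorem gradSq_eq (ψR ψZ θ : ℝ) : ψR ^ 2 + ψZ ^ 2 = radialDeriv ψR ψZ θ ^ 2 + tangentialDeriv ψR ψZ θ ^ 2 := by
  unfold radialDeriv tangentialDeriv
  have h := sin_sq_add_cos_sq θ
  nlinarith [h]

/-- `R`-component derivative of the loop: `d/dθ (R_c + ρ cos θ) = ρ′ cos θ − ρ sin θ`. [folklore] -/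
theorem hasDerivAt_loop_fst {Rc Zc : ℝ} {ρ : ℝ → ℝ} {ρ' θ : ℝ} (hρ : HasDerivAt ρ ρ' θ) :
    HasDerivAt (fun t => (loop Rc Zc ρ t).1) (ρ' * cos θ - ρ θ * sin θ) θ := by
  have h := (hρ.mul (hasDerivAt_cos θ)).const_add Rc
  have e : (fun t => (loop Rc Zc ρ t).1) = fun x => Rc + ρ x * cos x := by funext t; rfl
  rw [e, show ρ' * cos θ - ρ θ * sin θ = ρ' * cos θ + ρ θ * -sin θ by ring]
  exact h

/-- `Z`-component derivative of the loop: `d/dθ (Z_c + ρ sin θ) = ρ′ sin θ + ρ cos θ`. [folklore] -/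
theorem hasDerivAt_loop_snd {Rc Zc : ℝ} {ρ : ℝ → ℝ} {ρ' θ : ℝ} (hρ : HasDerivAt ρ ρ' θ) :
    HasDerivAt (fun t => (loop Rc Zc ρ t).2) (ρ' * sin θ + ρ θ * cos θ) θ := by
  have h := (hρ.mul (hasDerivAt_sin θ)).const_add Zc
  have e : (fun t => (loop Rc Zc ρ t).2) = fun x => Zc + ρ x * sin x := by funext t; rfl
  rw [e]
  exact h

/-- The loop as a map into `ℝ × ℝ` has derivative `(ρ′ cos θ − ρ sin θ, ρ′ sin θ + ρ cos θ)`. [folklore] -/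
theorem hasDerivAt_loop {Rc Zc : ℝ} {ρ : ℝ → ℝ} {ρ' θ : ℝ} (hρ : HasDerivAt ρ ρ' θ) :
    HasDerivAt (loop Rc Zc ρ) (ρ' * cos θ - ρ θ * sin θ, ρ' * sin θ + ρ θ * cos θ) θ :=
  (hasDerivAt_loop_fst (Zc := Zc) hρ).prodMk (hasDerivAt_loop_snd (Rc := Rc) hρ)

/-- Euclidean speed of the loop: `|γ′(θ)|² = ρ′² + ρ²`, i.e. `speed γ θ = √(ρ′² + ρ²)`. [folklore] -/
theorem speed_loop {Rc Zc : ℝ} {ρ : ℝ → ℝ} {ρ' θ : ℝ} (hρ : HasDerivAt ρ ρ' θ) :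
    speed (loop Rc Zc ρ) θ = Real.sqrt (ρ' ^ 2 + ρ θ ^ 2) := by
  unfold speed
  rw [(hasDerivAt_loop_fst (Rc := Rc) (Zc := Zc) hρ).deriv, (hasDerivAt_loop_snd (Rc := Rc) (Zc := Zc) hρ).deriv]
  congr 1
  have h := sin_sq_add_cos_sq θ
  nlinarith [h]

/-! ## §2 The cancellation `|γ′|·|D_r| = ρ·|∇ψ|` on a level set and the `(6.35)` integrand -/

/-- If `ψ` (as a map `ℝ × ℝ → ℝ`) is Fréchet-differentiable at `(R, Z)` with derivative `L`, its slot-wise partials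
`GradShafranov.dR`, `GradShafranov.dZ` there are `L (1, 0)` and `L (0, 1)`. [folklore] -/
theorem dR_dZ_of_hasFDerivAt {ψ : ℝ → ℝ → ℝ} {R Z : ℝ} {L : ℝ × ℝ →L[ℝ] ℝ}
    (hψ : HasFDerivAt (fun p : ℝ × ℝ => ψ p.1 p.2) L (R, Z)) :
    dR ψ R Z = L (1, 0) ∧ dZ ψ R Z = L (0, 1) := by
  constructor
  · -- restrict to the horizontal line through (R, Z)
    have hl : HasDerivAt (fun r : ℝ => ((r, Z) : ℝ × ℝ)) ((1 : ℝ), (0 : ℝ)) R :=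
      (hasDerivAt_id R).prodMk (hasDerivAt_const R Z)
    have hc' := hψ.comp_hasDerivAt R hl
    have hc : HasDerivAt (fun r : ℝ => ψ r Z) (L (1, 0)) R := hc'
    exact hc.deriv
  · have hl : HasDerivAt (fun z : ℝ => ((R, z) : ℝ × ℝ)) ((0 : ℝ), (1 : ℝ)) Z :=
      (hasDerivAt_const Z R).prodMk (hasDerivAt_id Z)
    have hc' := hψ.comp_hasDerivAt Z hl
    have hc : HasDerivAt (fun z : ℝ => ψ R z) (L (0, 1)) Z := hc'
    exact hc.deriv

/-- Chain rule along the loop: `d/dθ ψ(γ(θ)) = ρ′·D_r + ρ·D_t` with `(ψ_R, ψ_Z) = (L(1,0), L(0,1))`. [folklore] -/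
theorem hasDerivAt_comp_loop {ψ : ℝ → ℝ → ℝ} {Rc Zc : ℝ} {ρ : ℝ → ℝ} {ρ' θ : ℝ} {L : ℝ × ℝ →L[ℝ] ℝ}
    (hρ : HasDerivAt ρ ρ' θ) (hψ : HasFDerivAt (fun p : ℝ × ℝ => ψ p.1 p.2) L (loop Rc Zc ρ θ)) :
    HasDerivAt (fun t => ψ (loop Rc Zc ρ t).1 (loop Rc Zc ρ t).2)
      (ρ' * radialDeriv (L (1, 0)) (L (0, 1)) θ + ρ θ * tangentialDeriv (L (1, 0)) (L (0, 1)) θ) θ := by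
  have h := hψ.comp_hasDerivAt θ (hasDerivAt_loop hρ)
  have hL : L (ρ' * cos θ - ρ θ * sin θ, ρ' * sin θ + ρ θ * cos θ)
      = ρ' * radialDeriv (L (1, 0)) (L (0, 1)) θ + ρ θ * tangentialDeriv (L (1, 0)) (L (0, 1)) θ := by
    have e : ((ρ' * cos θ - ρ θ * sin θ, ρ' * sin θ + ρ θ * cos θ) : ℝ × ℝ)
        = (ρ' * cos θ - ρ θ * sin θ) • ((1 : ℝ), (0 : ℝ)) + (ρ' * sin θ + ρ θ * cos θ) • ((0 : ℝ), (1 : ℝ)) := by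
      ext <;> simp
    rw [e, map_add, map_smul, map_smul, smul_eq_mul, smul_eq_mul]
    unfold radialDeriv tangentialDeriv
    ring
  rw [← hL]
  exact h

/-- **THE CANCELLATION.**  On a level set (`d/dθ ψ(γ(θ)) = 0`) with `ρ(θ) > 0`:
`|γ′(θ)| · |D_r(θ)| = ρ(θ) · |∇ψ(γ(θ))|`. [folklore] -/
theorem speed_mul_abs_radialDeriv {ψ : ℝ → ℝ → ℝ} {Rc Zc : ℝ} {ρ : ℝ → ℝ} {ρ' θ : ℝ} {L : ℝ × ℝ →L[ℝ] ℝ}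
    (hρ : HasDerivAt ρ ρ' θ) (hρ0 : 0 < ρ θ)
    (hψ : HasFDerivAt (fun p : ℝ × ℝ => ψ p.1 p.2) L (loop Rc Zc ρ θ))
    (hlevel : HasDerivAt (fun t => ψ (loop Rc Zc ρ t).1 (loop Rc Zc ρ t).2) 0 θ) :
    speed (loop Rc Zc ρ) θ * |radialDeriv (L (1, 0)) (L (0, 1)) θ|
      = ρ θ * Real.sqrt (L (1, 0) ^ 2 + L (0, 1) ^ 2) := by
  set Dr := radialDeriv (L (1, 0)) (L (0, 1)) θ with hDr
  set Dt := tangentialDeriv (L (1, 0)) (L (0, 1)) θ with hDt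
  -- the level condition: ρ′ D_r + ρ D_t = 0
  have hzero : ρ' * Dr + ρ θ * Dt = 0 := (hasDerivAt_comp_loop hρ hψ).unique hlevel
  have hg : L (1, 0) ^ 2 + L (0, 1) ^ 2 = Dr ^ 2 + Dt ^ 2 := gradSq_eq _ _ θ
  rw [speed_loop hρ, hg]
  -- both sides are nonnegative; compare squares
  have hkey : (ρ' ^ 2 + ρ θ ^ 2) * Dr ^ 2 = ρ θ ^ 2 * (Dr ^ 2 + Dt ^ 2) := by
    linear_combination (ρ' * Dr - ρ θ * Dt) * hzero
  have h1 : 0 ≤ Real.sqrt (ρ' ^ 2 + ρ θ ^ 2) * |Dr| := by positivity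
  have h2 : 0 ≤ ρ θ * Real.sqrt (Dr ^ 2 + Dt ^ 2) := by positivity
  have hsq : (Real.sqrt (ρ' ^ 2 + ρ θ ^ 2) * |Dr|) ^ 2 = (ρ θ * Real.sqrt (Dr ^ 2 + Dt ^ 2)) ^ 2 := by
    rw [mul_pow, mul_pow, sq_abs, Real.sq_sqrt (by positivity), Real.sq_sqrt (by positivity)]
    exact hkey
  exact (pow_left_inj₀ h1 h2 two_ne_zero).1 hsq

/-- A non-vanishing radial derivative forces a non-vanishing gradient: `D_r ≠ 0 ⇒ √(ψ_R² + ψ_Z²) > 0`. [folklore] -/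
theorem gradNorm_pos_of_radialDeriv_ne {ψR ψZ θ : ℝ} (hDr : radialDeriv ψR ψZ θ ≠ 0) :
    0 < Real.sqrt (ψR ^ 2 + ψZ ^ 2) := by
  apply Real.sqrt_pos.2
  rcases (show (0 : ℝ) ≤ ψR ^ 2 + ψZ ^ 2 by positivity).lt_or_eq with h | h
  · exact h
  · exfalso
    have h10 : ψR = 0 := by nlinarith [sq_nonneg ψR, sq_nonneg ψZ]
    have h01 : ψZ = 0 := by nlinarith [sq_nonneg ψR, sq_nonneg ψZ]
    exact hDr (by unfold radialDeriv; rw [h10, h01]; ring)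

/-- **`|γ′(θ)| / |∇ψ| = ρ(θ)/|D_r(θ)|`** on a level set, when `D_r(θ) ≠ 0`. [folklore] -/
theorem speed_div_grad {ψ : ℝ → ℝ → ℝ} {Rc Zc : ℝ} {ρ : ℝ → ℝ} {ρ' θ : ℝ} {L : ℝ × ℝ →L[ℝ] ℝ}
    (hρ : HasDerivAt ρ ρ' θ) (hρ0 : 0 < ρ θ)
    (hψ : HasFDerivAt (fun p : ℝ × ℝ => ψ p.1 p.2) L (loop Rc Zc ρ θ))
    (hlevel : HasDerivAt (fun t => ψ (loop Rc Zc ρ t).1 (loop Rc Zc ρ t).2) 0 θ)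
    (hDr : radialDeriv (L (1, 0)) (L (0, 1)) θ ≠ 0) :
    speed (loop Rc Zc ρ) θ / Real.sqrt (L (1, 0) ^ 2 + L (0, 1) ^ 2)
      = ρ θ / |radialDeriv (L (1, 0)) (L (0, 1)) θ| := by
  have h := speed_mul_abs_radialDeriv hρ hρ0 hψ hlevel
  have hD : 0 < |radialDeriv (L (1, 0)) (L (0, 1)) θ| := abs_pos.2 hDr
  have hG := gradNorm_pos_of_radialDeriv_ne hDr
  rw [div_eq_div_iff hG.ne' hD.ne']
  exact h

/-- Poloidal field magnitude from a Fréchet derivative: `B_p(R, Z) = √(ψ_R² + ψ_Z²)/|R|`. [cite: Freidberg2014, §6.2.1 eq. (6.3)] -/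
theorem fieldBpol_of_hasFDerivAt {ψ : ℝ → ℝ → ℝ} {R Z : ℝ} {L : ℝ × ℝ →L[ℝ] ℝ}
    (hψ : HasFDerivAt (fun p : ℝ × ℝ => ψ p.1 p.2) L (R, Z)) (hR : R ≠ 0) :
    fieldBpol ψ R Z = Real.sqrt (L (1, 0) ^ 2 + L (0, 1) ^ 2) / |R| := by
  obtain ⟨hdR, hdZ⟩ := dR_dZ_of_hasFDerivAt hψ
  unfold fieldBpol fieldBR fieldBZ
  rw [hdR, hdZ]
  have hR2 : 0 < R ^ 2 := by positivity
  have e : (-(R⁻¹ * L (0, 1))) ^ 2 + (R⁻¹ * L (1, 0)) ^ 2 = (L (1, 0) ^ 2 + L (0, 1) ^ 2) / R ^ 2 := by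
    field_simp; ring
  rw [e, Real.sqrt_div (by positivity), Real.sqrt_sq_eq_abs]

/-- **THE `(6.35)` INTEGRAND ON A POLAR-RAY LEVEL SET**: `(1/(R²B_p))·|γ′(θ)| = ρ(θ)/(R(θ)·|D_r(θ)|)` for `R(θ) > 0`.
[cite: Freidberg2014, §6.3.5 eq. (6.35)] -/
theorem safetyFactor_integrand {ψ : ℝ → ℝ → ℝ} {Rc Zc : ℝ} {ρ : ℝ → ℝ} {ρ' θ : ℝ} {L : ℝ × ℝ →L[ℝ] ℝ}
    (hρ : HasDerivAt ρ ρ' θ) (hρ0 : 0 < ρ θ)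
    (hψ : HasFDerivAt (fun p : ℝ × ℝ => ψ p.1 p.2) L (loop Rc Zc ρ θ))
    (hlevel : HasDerivAt (fun t => ψ (loop Rc Zc ρ t).1 (loop Rc Zc ρ t).2) 0 θ)
    (hDr : radialDeriv (L (1, 0)) (L (0, 1)) θ ≠ 0) (hR : 0 < (loop Rc Zc ρ θ).1) :
    1 / ((loop Rc Zc ρ θ).1 ^ 2 * fieldBpol ψ (loop Rc Zc ρ θ).1 (loop Rc Zc ρ θ).2) * speed (loop Rc Zc ρ) θ
      = ρ θ / ((loop Rc Zc ρ θ).1 * |radialDeriv (L (1, 0)) (L (0, 1)) θ|) := by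
  have hpt : ((loop Rc Zc ρ θ).1, (loop Rc Zc ρ θ).2) = loop Rc Zc ρ θ := rfl
  have hψ' : HasFDerivAt (fun p : ℝ × ℝ => ψ p.1 p.2) L ((loop Rc Zc ρ θ).1, (loop Rc Zc ρ θ).2) := by rw [hpt]; exact hψ
  rw [fieldBpol_of_hasFDerivAt hψ' hR.ne', abs_of_pos hR]
  have hq := speed_div_grad hρ hρ0 hψ hlevel hDr
  have hG := gradNorm_pos_of_radialDeriv_ne hDr
  have hD : 0 < |radialDeriv (L (1, 0)) (L (0, 1)) θ| := abs_pos.2 hDr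
  set R := (loop Rc Zc ρ θ).1
  set G := Real.sqrt (L (1, 0) ^ 2 + L (0, 1) ^ 2)
  set D := |radialDeriv (L (1, 0)) (L (0, 1)) θ|
  set S := speed (loop Rc Zc ρ) θ
  have e1 : 1 / (R ^ 2 * (G / R)) * S = (S / G) / R := by
    field_simp
  rw [e1, hq, div_div, mul_comm D R]

/-- **FREIDBERG'S `q` AS A PLAIN `θ`-INTEGRAL.**  If the flux surface is the polar-ray loop on `[0, 2π]` — `ρ` differentiable
and positive, `ψ` Fréchet-differentiable at the loop points with derivative `L θ`, `ψ∘γ` stationary (level set), radial derivative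
non-vanishing, `R > 0` — then `q = (F/2π)∮ dl/(R²B_p) = (F/2π) ∫₀^{2π} ρ(θ)/(R(θ)·|D_r(θ)|) dθ`. [cite: Freidberg2014, §6.3.5 eq. (6.35)] -/
theorem safetyFactorE_eq_polar {ψ : ℝ → ℝ → ℝ} {Rc Zc F : ℝ} {ρ ρ' : ℝ → ℝ} {L : ℝ → (ℝ × ℝ →L[ℝ] ℝ)}
    (hρ : ∀ θ ∈ uIcc 0 (2 * π), HasDerivAt ρ (ρ' θ) θ) (hρ0 : ∀ θ ∈ uIcc 0 (2 * π), 0 < ρ θ)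
    (hψ : ∀ θ ∈ uIcc 0 (2 * π), HasFDerivAt (fun p : ℝ × ℝ => ψ p.1 p.2) (L θ) (loop Rc Zc ρ θ))
    (hlevel : ∀ θ ∈ uIcc 0 (2 * π), HasDerivAt (fun t => ψ (loop Rc Zc ρ t).1 (loop Rc Zc ρ t).2) 0 θ)
    (hDr : ∀ θ ∈ uIcc 0 (2 * π), radialDeriv (L θ (1, 0)) (L θ (0, 1)) θ ≠ 0)
    (hR : ∀ θ ∈ uIcc 0 (2 * π), 0 < (loop Rc Zc ρ θ).1) :
    safetyFactorE F ψ (loop Rc Zc ρ) (2 * π)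
      = F / (2 * π) * ∫ θ in (0 : ℝ)..(2 * π), ρ θ / ((loop Rc Zc ρ θ).1 * |radialDeriv (L θ (1, 0)) (L θ (0, 1)) θ|) := by
  unfold safetyFactorE loopIntegralE
  congr 1
  apply intervalIntegral.integral_congr
  intro θ hθ
  exact safetyFactor_integrand (hρ θ hθ) (hρ0 θ hθ) (hψ θ hθ) (hlevel θ hθ) (hDr θ hθ) (hR θ hθ)

/-- The same rewrite for ANY loop functional `∮ g dl/(R²B_p)`-type integrand: `loopIntegralE γ (2π) (g/(R²B_p))
= ∫₀^{2π} g(γθ)·ρ/(R·|D_r|) dθ`. [cite: Freidberg2014, §6.3.2 eq. (6.22)] -/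
theorem loopIntegralE_eq_polar {ψ : ℝ → ℝ → ℝ} {Rc Zc : ℝ} {ρ ρ' : ℝ → ℝ} {L : ℝ → (ℝ × ℝ →L[ℝ] ℝ)} (g : ℝ → ℝ → ℝ)
    (hρ : ∀ θ ∈ uIcc 0 (2 * π), HasDerivAt ρ (ρ' θ) θ) (hρ0 : ∀ θ ∈ uIcc 0 (2 * π), 0 < ρ θ)
    (hψ : ∀ θ ∈ uIcc 0 (2 * π), HasFDerivAt (fun p : ℝ × ℝ => ψ p.1 p.2) (L θ) (loop Rc Zc ρ θ))
    (hlevel : ∀ θ ∈ uIcc 0 (2 * π), HasDerivAt (fun t => ψ (loop Rc Zc ρ t).1 (loop Rc Zc ρ t).2) 0 θ)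
    (hDr : ∀ θ ∈ uIcc 0 (2 * π), radialDeriv (L θ (1, 0)) (L θ (0, 1)) θ ≠ 0)
    (hR : ∀ θ ∈ uIcc 0 (2 * π), 0 < (loop Rc Zc ρ θ).1) :
    loopIntegralE (loop Rc Zc ρ) (2 * π) (fun R Z => g R Z / (R ^ 2 * fieldBpol ψ R Z))
      = ∫ θ in (0 : ℝ)..(2 * π), g (loop Rc Zc ρ θ).1 (loop Rc Zc ρ θ).2
          * (ρ θ / ((loop Rc Zc ρ θ).1 * |radialDeriv (L θ (1, 0)) (L θ (0, 1)) θ|)) := by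
  unfold loopIntegralE
  apply intervalIntegral.integral_congr
  intro θ hθ
  have h := safetyFactor_integrand (hρ θ hθ) (hρ0 θ hθ) (hψ θ hθ) (hlevel θ hθ) (hDr θ hθ) (hR θ hθ)
  simp only at h ⊢
  rw [← h]
  ring

/-! ## §3 Bracketing the ray root: a strictly increasing ray profile with a sign change has exactly one root in the bracket -/

/-- The ray profile `s ↦ ψ(R_c + s cos θ, Z_c + s sin θ)`. [folklore] -/
def rayProfile (ψ : ℝ → ℝ → ℝ) (Rc Zc θ s : ℝ) : ℝ := ψ (Rc + s * cos θ) (Zc + s * sin θ)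

/-- **RAY-ROOT CERTIFICATE SHAPE.**  If the ray profile is continuous and strictly increasing on `[s₁, s₂]` and
`ψ(ray s₁) < c < ψ(ray s₂)`, then there is EXACTLY ONE `s ∈ (s₁, s₂)` on the surface `ψ = c` along that ray (the ray radius
`ρ(θ)`), and every such root lies in the open bracket. [folklore] -/
theorem existsUnique_rayRoot {ψ : ℝ → ℝ → ℝ} {Rc Zc θ s₁ s₂ c : ℝ} (hs : s₁ ≤ s₂)
    (hcont : ContinuousOn (rayProfile ψ Rc Zc θ) (Icc s₁ s₂))
    (hmono : StrictMonoOn (rayProfile ψ Rc Zc θ) (Icc s₁ s₂))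
    (h₁ : rayProfile ψ Rc Zc θ s₁ < c) (h₂ : c < rayProfile ψ Rc Zc θ s₂) :
    ∃! s, s ∈ Icc s₁ s₂ ∧ rayProfile ψ Rc Zc θ s = c := by
  -- existence by the intermediate value theorem
  have hivt : c ∈ rayProfile ψ Rc Zc θ '' Icc s₁ s₂ := by
    have := intermediate_value_Icc hs hcont
    exact this ⟨h₁.le, h₂.le⟩
  obtain ⟨s, hsI, hsc⟩ := hivt
  refine ⟨s, ⟨hsI, hsc⟩, ?_⟩
  rintro s' ⟨hs'I, hs'c⟩
  exact hmono.injOn hs'I hsI (by rw [hs'c, hsc])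

/-- … and the root is INTERIOR: `s₁ < ρ < s₂`. [folklore] -/
theorem rayRoot_mem_Ioo {ψ : ℝ → ℝ → ℝ} {Rc Zc θ s₁ s₂ c s : ℝ} (hsI : s ∈ Icc s₁ s₂)
    (hsc : rayProfile ψ Rc Zc θ s = c) (h₁ : rayProfile ψ Rc Zc θ s₁ < c) (h₂ : c < rayProfile ψ Rc Zc θ s₂) :
    s ∈ Ioo s₁ s₂ := by
  refine ⟨lt_of_le_of_ne hsI.1 ?_, lt_of_le_of_ne hsI.2 ?_⟩
  · intro h; rw [← h] at hsc; exact (ne_of_lt h₁) hsc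
  · intro h; rw [h] at hsc; exact (ne_of_gt h₂) hsc

/-- A positive radial derivative along the ray makes the profile strictly increasing (sufficient condition for §3's
bracketing, the form an interval certificate checks: `D_r > 0` on the box). [folklore] -/
theorem strictMonoOn_rayProfile_of_deriv_pos {ψ : ℝ → ℝ → ℝ} {Rc Zc θ s₁ s₂ : ℝ}
    (hcont : ContinuousOn (rayProfile ψ Rc Zc θ) (Icc s₁ s₂))
    (hderiv : ∀ s ∈ Ioo s₁ s₂, 0 < deriv (rayProfile ψ Rc Zc θ) s) :
    StrictMonoOn (rayProfile ψ Rc Zc θ) (Icc s₁ s₂) :=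
  strictMonoOn_of_deriv_pos (convex_Icc s₁ s₂) hcont (by simpa [interior_Icc] using hderiv)

end PolarRay

end Summit.Ventures.FusionMHD.Models

end
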